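import Literature.NumberTheory.LFunctions.VinogradovKorobovTrigIntegral
import HarnessLib

/-!
# Khale 2024, Lemma 7.1 and (7.1)–(7.2): the trigonometric inequality for `L(s, χ^j)`

Topic `Literature/NumberTheory/LFunctions`.  Everything in this file is PROVED; the only `def` is
the coefficient family `khaleB a₁ a₂` of (7.2) (no named fact is introduced).
**§7 of T. Khale, *An explicit Vinogradov–Korobov zero-free region for Dirichlet L-functions*,
Q. J. Math. 75 (2024) = arXiv:2210.06457v1 (pp. 17–18)**:

> (7.1)–(7.2) For real `a₁, a₂` put `b₄ = 1`, `b₃ = 4(a₁ + a₂)`, `b₂ = 4(1 + a₁² + a₂² + 4a₁a₂)`,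
> `b₁ = (a₁ + a₂)(12 + 16a₁a₂)`, `b₀ = b₂ − 1 + 8(a₁a₂)²`; then
> `Σ_{j=0}^{4} b_j cos(jθ) = 8(a₁ + cos θ)²(a₂ + cos θ)² ≥ 0`.
>
> **Lemma 7.1.** `∫_{−∞}^{∞} (1/cosh²u) Σ_{j=1}^{4} b_j log|L(σ + η + ijt₁ + iut₂, χ^j)| du ≥ −2b₀ log ζ(1 + η)`.

This is the `L`-function version of Ford's Lemma 5.1 (*Zero-free regions for the Riemann zeta
function*, 2002), whose `ζ` version for every degree is the tree's `FordTrig.mty_lemma_4_4_core`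
(`VinogradovKorobovTrigIntegral.lean`); we follow that file line by line, inserting the character:
`log|L(s, ψ)| = Σ_p Re(−log(1 − ψ(p)p^{−s}))` (Mathlib's
`DirichletCharacter.LSeries_eulerProduct_exp_log`), the Mercator series of one Euler factor on a
vertical line with the phase `arg χ(p)` (`ψ = χ^j`, `χ^j(p) = e^{ij arg χ(p)}` for `p ∤ q` and `= 0`
for `p ∣ q`, including `j = 0`), Ford's (5.3) `∫ cos(φ + yu)/cosh²u du = U(y) cos φ`,
`0 ≤ U ≤ 2` (`Literature/Analysis/SpecialFunctions/SechSqFourier.lean`), two dominated-convergence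
interchanges, and the pointwise inequality `Σ_{j=1}^{K} b_j cos(jx) ≥ −b₀`
(`FordTrig.sum_mul_cos_ge`) at `x = m(t₁ log p − arg χ(p))`; the primes `p ∣ q` contribute `0` on
the left and `≤ 0` on the right.  As in the `ζ` file the result is proved for every non-negative
cosine polynomial (`IsNonnegTrigPoly K b`) and every real part `σ > 1`, with `−2b₀ log ζ(σ)` on the
right (`KhaleL71.lemma71_core`, `KhaleL71.lemma71`); the printed form with `σ + η ≥ 1 + η` and
`ζ(1 + η)` follows from the monotonicity of `ζ` on `(1, ∞)` (`KhaleL71.lemma71_printed`).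

## Main statements

* `khaleB a₁ a₂`, `KhaleL71.trigPoly_khaleB` — (7.2) and the identity (7.1);
  `KhaleL71.isNonnegTrigPoly_khaleB` — for `a₁, a₂ ≥ 0` with `b₀ < b₁` it is an admissible polynomial;
  `KhaleL71.khaleB_values` — the values `b₀ = 10.01055, …, b₅ = 33.3275` at `a₁ = 0.225, a₂ = 0.9`
  (proof of Lemma 9.1).
* `KhaleL71.hasSum_eulerLogRe_char` — `log|L(s, ψ)| = Σ_p Re(−log(1 − ψ(p)p^{−s}))`, `Re s > 1`.
* `KhaleL71.lemma71_core`, `KhaleL71.lemma71`, `KhaleL71.lemma71_printed` — **Lemma 7.1**.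

## References

* T. Khale, arXiv:2210.06457v1, §7: (7.1), (7.2), Lemma 7.1 (pp. 17–18). [Khale2024]
* K. Ford, *Zero-free regions for the Riemann zeta function*, Number Theory for the Millennium II
  (2002), 25–56 = arXiv:1910.08205, Lemma 5.1, (5.2)–(5.4). [Ford2002Millennium]
-/

noncomputable section

open Complex Real MeasureTheory Finset Filter
open scoped Topology

namespace Literature.NumberTheory.LFunctions

/-- **Khale's coefficients (7.2)**: `b₄ = 1`, `b₃ = 4(a₁ + a₂)`, `b₂ = 4(1 + a₁² + a₂² + 4a₁a₂)`,
`b₁ = (a₁ + a₂)(12 + 16a₁a₂)`, `b₀ = b₂ − 1 + 8(a₁a₂)²` (and `0` beyond degree `4`).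
[cite: Khale2024, (7.2)] -/
def khaleB (a₁ a₂ : ℝ) : ℕ → ℝ
  | 0 => 4 * (1 + a₁ ^ 2 + a₂ ^ 2 + 4 * a₁ * a₂) - 1 + 8 * (a₁ * a₂) ^ 2
  | 1 => (a₁ + a₂) * (12 + 16 * a₁ * a₂)
  | 2 => 4 * (1 + a₁ ^ 2 + a₂ ^ 2 + 4 * a₁ * a₂)
  | 3 => 4 * (a₁ + a₂)
  | 4 => 1
  | _ + 5 => 0

namespace KhaleL71

open FordTrig Literature.Analysis.SpecialFunctions

/-! ## (7.1): `Σ_{j=0}^{4} b_j cos(jθ) = 8(a₁ + cos θ)²(a₂ + cos θ)² ≥ 0` -/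

/-- **(7.1)**: `Σ_{j=0}^{4} b_j cos(jθ) = 8(a₁ + cos θ)²(a₂ + cos θ)²`. [cite: Khale2024, (7.1)] -/
theorem trigPoly_khaleB (a₁ a₂ θ : ℝ) :
    trigPoly 4 (khaleB a₁ a₂) θ = 8 * (a₁ + Real.cos θ) ^ 2 * (a₂ + Real.cos θ) ^ 2 := by
  rw [trigPoly]
  simp only [Finset.sum_range_succ, Finset.sum_range_zero, zero_add, khaleB]
  push_cast
  simp only [zero_mul, Real.cos_zero, mul_one, one_mul]
  have h2 : Real.cos (2 * θ) = 2 * Real.cos θ ^ 2 - 1 := Real.cos_two_mul θ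
  have h3 : Real.cos (3 * θ) = 4 * Real.cos θ ^ 3 - 3 * Real.cos θ := Real.cos_three_mul θ
  have h4 : Real.cos (4 * θ) = 8 * Real.cos θ ^ 4 - 8 * Real.cos θ ^ 2 + 1 := by
    rw [show (4 : ℝ) * θ = 2 * (2 * θ) by ring, Real.cos_two_mul, h2]; ring
  rw [h2, h3, h4]
  ring

/-- `Σ_{j=0}^{4} b_j cos(jθ) ≥ 0`. [cite: Khale2024, (7.1)] -/
theorem trigPoly_khaleB_nonneg (a₁ a₂ θ : ℝ) : 0 ≤ trigPoly 4 (khaleB a₁ a₂) θ := by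
  rw [trigPoly_khaleB]; positivity

/-- For `a₁, a₂ ≥ 0` with `b₀ < b₁`, (7.2) is a non-negative trigonometric polynomial of degree `4`
in the sense of `IsNonnegTrigPoly`. [cite: Khale2024, (7.1)–(7.2)] -/
theorem isNonnegTrigPoly_khaleB {a₁ a₂ : ℝ} (h₁ : 0 ≤ a₁) (h₂ : 0 ≤ a₂)
    (h01 : khaleB a₁ a₂ 0 < khaleB a₁ a₂ 1) : IsNonnegTrigPoly 4 (khaleB a₁ a₂) := by
  refine ⟨fun k ↦ ?_, h01, trigPoly_khaleB_nonneg a₁ a₂⟩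
  match k with
  | 0 => simp only [khaleB]; nlinarith [mul_nonneg h₁ h₂, sq_nonneg a₁, sq_nonneg a₂]
  | 1 => simp only [khaleB]; positivity
  | 2 => simp only [khaleB]; positivity
  | 3 => simp only [khaleB]; positivity
  | 4 => simp only [khaleB]; norm_num
  | _ + 5 => simp only [khaleB]; norm_num

/-- **The values at `a₁ = 0.225`, `a₂ = 0.9`** (proof of Lemma 9.1): `b₀ = 10.01055`,
`b₁ = 17.145`, `b₂ = 10.6825`, `b₃ = 4.5`, `b₄ = 1`, `b₁ + b₂ + b₃ + b₄ = 33.3275`.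
[cite: Khale2024, Lemma 9.1 (proof)] -/
theorem khaleB_values :
    khaleB 0.225 0.9 0 = 10.01055 ∧ khaleB 0.225 0.9 1 = 17.145 ∧ khaleB 0.225 0.9 2 = 10.6825 ∧
      khaleB 0.225 0.9 3 = 4.5 ∧ khaleB 0.225 0.9 4 = 1 ∧
      khaleB 0.225 0.9 1 + khaleB 0.225 0.9 2 + khaleB 0.225 0.9 3 + khaleB 0.225 0.9 4 = 33.3275 := by
  simp only [khaleB]; norm_num

/-- Khale's polynomial (`a₁ = 0.225`, `a₂ = 0.9`) is admissible. [cite: Khale2024, Lemma 9.1 (proof)] -/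
theorem isNonnegTrigPoly_khaleB_khale : IsNonnegTrigPoly 4 (khaleB 0.225 0.9) :=
  isNonnegTrigPoly_khaleB (by norm_num) (by norm_num) (by simp only [khaleB]; norm_num)

/-! ## Euler factors with a coefficient `ε`, `‖ε‖ ≤ 1` -/

/-- `‖ε p^{−s}‖ < 1` for `‖ε‖ ≤ 1`, `Re s > 0`. [folklore] -/
theorem norm_coeff_mul_lt_one {ε : ℂ} (hε : ‖ε‖ ≤ 1) (p : Nat.Primes) {s : ℂ} (hs : 0 < s.re) :
    ‖ε * (p : ℂ) ^ (-s)‖ < 1 := by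
  rw [norm_mul]
  calc ‖ε‖ * ‖(p : ℂ) ^ (-s)‖ ≤ 1 * ‖(p : ℂ) ^ (-s)‖ := by gcongr
    _ < 1 := by rw [one_mul]; exact norm_prime_cpow_neg_lt_one p hs

/-- `‖ε p^{−s}‖ ≤ p^{−Re s} ≤ 1/2` for `‖ε‖ ≤ 1`, `Re s ≥ 1`. [folklore] -/
theorem norm_coeff_mul_le {ε : ℂ} (hε : ‖ε‖ ≤ 1) (p : Nat.Primes) (s : ℂ) :
    ‖ε * (p : ℂ) ^ (-s)‖ ≤ (p : ℝ) ^ (-s.re) := by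
  rw [norm_mul, ← norm_prime_cpow_neg]
  calc ‖ε‖ * ‖(p : ℂ) ^ (-s)‖ ≤ 1 * ‖(p : ℂ) ^ (-s)‖ := by gcongr
    _ = _ := one_mul _

/-- `|Re(−log(1 − ε p^{−s}))| ≤ (3/2) p^{−Re s}` for `‖ε‖ ≤ 1`, `Re s ≥ 1`. [folklore] -/
theorem abs_eulerLogRe_coeff_le {ε : ℂ} (hε : ‖ε‖ ≤ 1) (p : Nat.Primes) {s : ℂ} (hs : 1 ≤ s.re) :
    |(-Complex.log (1 - ε * (p : ℂ) ^ (-s))).re| ≤ 3 / 2 * (p : ℝ) ^ (-s.re) := by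
  have hz : ‖ε * (p : ℂ) ^ (-s)‖ ≤ 1 / 2 :=
    (norm_coeff_mul_le hε p s).trans (by rw [← norm_prime_cpow_neg]; exact norm_prime_cpow_neg_le_half p hs)
  calc |(-Complex.log (1 - ε * (p : ℂ) ^ (-s))).re| ≤ ‖-Complex.log (1 - ε * (p : ℂ) ^ (-s))‖ :=
        Complex.abs_re_le_norm _
    _ = ‖Complex.log (1 + -(ε * (p : ℂ) ^ (-s)))‖ := by rw [norm_neg, sub_eq_add_neg]
    _ ≤ 3 / 2 * ‖-(ε * (p : ℂ) ^ (-s))‖ := Complex.norm_log_one_add_half_le_self (by rwa [norm_neg])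
    _ ≤ 3 / 2 * (p : ℝ) ^ (-s.re) := by rw [norm_neg]; gcongr; exact norm_coeff_mul_le hε p s

/-! ## Euler product for `log|L(s, ψ)|` -/

variable {q : ℕ}

/-- **`log|L(s, ψ)| = Σ_p Re(−log(1 − ψ(p)p^{−s}))`** for `Re s > 1` and any Dirichlet character
`ψ`. [cite: Khale2024, Lemma 7.1 (proof)] -/
theorem hasSum_eulerLogRe_char [NeZero q] (ψ : DirichletCharacter ℂ q) {s : ℂ} (hs : 1 < s.re) :
    HasSum (fun p : Nat.Primes ↦ (-Complex.log (1 - ψ p * (p : ℂ) ^ (-s))).re)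
      (Real.log ‖ψ.LFunction s‖) := by
  have hsum := DirichletCharacter.summable_neg_log_one_sub_mul_prime_cpow ψ hs
  rw [DirichletCharacter.LFunction_eq_LSeries ψ hs, ← DirichletCharacter.LSeries_eulerProduct_exp_log ψ hs,
    Complex.norm_exp, Real.log_exp]
  exact Complex.hasSum_re hsum.hasSum

/-- `|log|L(s, ψ)|| ≤ (3/2) Σ_p p^{−Re s}` for `Re s > 1`. [folklore] -/
theorem abs_log_norm_LFunction_le [NeZero q] (ψ : DirichletCharacter ℂ q) {s : ℂ} (hs : 1 < s.re) :
    |Real.log ‖ψ.LFunction s‖| ≤ 3 / 2 * ∑' p : Nat.Primes, (p : ℝ) ^ (-s.re) := by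
  have h := hasSum_eulerLogRe_char ψ hs
  have hS := summable_prime_rpow_neg hs
  have hb : ∀ p : Nat.Primes, ‖(-Complex.log (1 - ψ p * (p : ℂ) ^ (-s))).re‖ ≤ 3 / 2 * (p : ℝ) ^ (-s.re) :=
    fun p ↦ by rw [Real.norm_eq_abs]; exact abs_eulerLogRe_coeff_le (ψ.norm_le_one _) p hs.le
  have hn : Summable fun p : Nat.Primes ↦ ‖(-Complex.log (1 - ψ p * (p : ℂ) ^ (-s))).re‖ :=
    (hS.mul_left (3 / 2)).of_nonneg_of_le (fun _ ↦ norm_nonneg _) hb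
  rw [← h.tsum_eq, ← Real.norm_eq_abs, ← tsum_mul_left]
  exact (norm_tsum_le_tsum_norm hn).trans (hn.tsum_le_tsum hb (hS.mul_left _))

/-! ## The values `χ^j(p)` -/

/-- For `p ∤ q`, `χ^j(p) = e^{ij arg χ(p)}` (`|χ(p)| = 1`), for every `j ≥ 0` (for `j = 0`, `χ⁰ = χ₀`
takes the value `1` at the unit `p`). [folklore] -/
theorem pow_apply_prime_of_not_dvd (χ : DirichletCharacter ℂ q) {p : ℕ} (hp : p.Prime)
    (hpq : ¬p ∣ q) (j : ℕ) :
    (χ ^ j) (p : ZMod q) = Complex.exp ((((j : ℝ) * Complex.arg (χ (p : ZMod q)) : ℝ) : ℂ) * I) := by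
  obtain ⟨u, hu'⟩ := ZMod.isUnit_prime_of_not_dvd hp hpq
  rw [← hu', MulChar.pow_apply_coe]
  set θ : ℝ := Complex.arg (χ (u : ZMod q)) with hθ
  have h1 : ‖χ (u : ZMod q)‖ = 1 := χ.unit_norm_eq_one u
  have h2 : χ (u : ZMod q) = Complex.exp ((θ : ℂ) * I) := by
    have := Complex.norm_mul_exp_arg_mul_I (χ (u : ZMod q))
    rw [h1, ← hθ] at this
    simpa using this.symm
  rw [h2, ← Complex.exp_nat_mul]
  congr 1
  push_cast
  ring

/-- For `p ∣ q`, `χ^j(p) = 0` for every `j ≥ 0` (`p` is not a unit mod `q`). [folklore] -/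
theorem pow_apply_prime_of_dvd (χ : DirichletCharacter ℂ q) {p : ℕ} (hp : p.Prime) (hpq : p ∣ q)
    (j : ℕ) : (χ ^ j) (p : ZMod q) = 0 :=
  MulChar.map_nonunit _ ((ZMod.isUnit_prime_iff_not_dvd hp).not.mpr (not_not.mpr hpq))

/-! ## One Euler factor with a phase on a vertical line -/

/-- **Mercator expansion of one Euler factor with a unimodular coefficient on a vertical line**:
for `σ > 0` and real `φ, v`,
`Re(−log(1 − e^{iφ} p^{−σ−iv})) = Σ_{m ≥ 1} m⁻¹ e^{−mσ log p} cos(m(v log p − φ))`.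
[cite: Khale2024, Lemma 7.1 (proof)] -/
theorem hasSum_eulerLogRe_line_phase (p : Nat.Primes) {σ : ℝ} (hσ : 0 < σ) (φ v : ℝ) :
    HasSum (fun n : ℕ ↦ Real.exp (-(n * (σ * Real.log p))) / n * Real.cos (n * (Real.log p * v - φ)))
      (-Complex.log (1 - Complex.exp ((φ : ℂ) * I) * (p : ℂ) ^ (-((σ : ℂ) + (v : ℂ) * I)))).re := by
  set L : ℝ := Real.log p with hL
  have hp0 : (p : ℂ) ≠ 0 := by exact_mod_cast p.prop.ne_zero
  set w : ℂ := ((-(σ * L) : ℝ) : ℂ) + ((φ - L * v : ℝ) : ℂ) * I with hw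
  have hz : Complex.exp ((φ : ℂ) * I) * (p : ℂ) ^ (-((σ : ℂ) + (v : ℂ) * I)) = Complex.exp w := by
    rw [Complex.cpow_def_of_ne_zero hp0, ← Complex.natCast_log, ← hL, ← Complex.exp_add, hw]
    congr 1
    push_cast
    ring
  have hnorm : ‖Complex.exp ((φ : ℂ) * I) * (p : ℂ) ^ (-((σ : ℂ) + (v : ℂ) * I))‖ < 1 :=
    norm_coeff_mul_lt_one (by rw [Complex.norm_exp_ofReal_mul_I]) p (by simpa using hσ)
  have h := Complex.hasSum_re (Complex.hasSum_taylorSeries_neg_log hnorm)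
  have e : (fun n : ℕ ↦ ((Complex.exp ((φ : ℂ) * I) * (p : ℂ) ^ (-((σ : ℂ) + (v : ℂ) * I))) ^ n / n).re) =
      fun n : ℕ ↦ Real.exp (-(n * (σ * L))) / n * Real.cos (n * (L * v - φ)) := by
    funext n
    rw [Complex.div_natCast_re, hz, ← Complex.exp_nat_mul, Complex.exp_re]
    have hre : ((n : ℂ) * w).re = -(n * (σ * L)) := by simp [hw]
    have him : ((n : ℂ) * w).im = n * (φ - L * v) := by simp [hw]
    rw [hre, him, show (n : ℝ) * (φ - L * v) = -(n * (L * v - φ)) by ring, Real.cos_neg]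
    ring
  rw [e] at h
  exact h

/-- Continuity of `u ↦ Re(−log(1 − ε p^{−s(u)}))` along `s(u) = σ + i(τ + κu)`, `σ > 0`,
`‖ε‖ ≤ 1`. [folklore] -/
theorem continuous_eulerLogRe_coeff_line {ε : ℂ} (hε : ‖ε‖ ≤ 1) (p : Nat.Primes) {σ : ℝ}
    (hσ : 0 < σ) (τ κ : ℝ) :
    Continuous fun u : ℝ ↦
      (-Complex.log (1 - ε * (p : ℂ) ^ (-((σ : ℂ) + ((τ + u * κ : ℝ) : ℂ) * I)))).re := by
  have hp0 : (p : ℂ) ≠ 0 := by exact_mod_cast p.prop.ne_zero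
  have h1 : Continuous fun u : ℝ ↦ ε * (p : ℂ) ^ (-((σ : ℂ) + ((τ + u * κ : ℝ) : ℂ) * I)) :=
    continuous_const.mul (Continuous.const_cpow (by fun_prop) (Or.inl hp0))
  have h2 : Continuous fun u : ℝ ↦
      Complex.log (1 - ε * (p : ℂ) ^ (-((σ : ℂ) + ((τ + u * κ : ℝ) : ℂ) * I))) := by
    refine Continuous.clog (continuous_const.sub h1) fun u ↦ ?_
    rw [sub_eq_add_neg]
    refine Complex.mem_slitPlane_of_norm_lt_one ?_
    rw [norm_neg]
    exact norm_coeff_mul_lt_one hε p (by simpa using hσ)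
  exact Complex.continuous_re.comp h2.neg

/-- `Re(−log(1 − ε p^{−s(u)}))/cosh²u` is integrable along `Re s = σ ≥ 1`, `‖ε‖ ≤ 1`. [folklore] -/
theorem integrable_eulerLogRe_coeff_line {ε : ℂ} (hε : ‖ε‖ ≤ 1) (p : Nat.Primes) {σ : ℝ}
    (hσ : 1 ≤ σ) (τ κ : ℝ) :
    Integrable fun u : ℝ ↦
      (-Complex.log (1 - ε * (p : ℂ) ^ (-((σ : ℂ) + ((τ + u * κ : ℝ) : ℂ) * I)))).re
        / Real.cosh u ^ 2 := by
  refine integrable_div_cosh_sq_of_bound (continuous_eulerLogRe_coeff_line hε p (by linarith) τ κ)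
    (M := 3 / 2 * (p : ℝ) ^ (-σ)) fun u ↦ ?_
  have hs : 1 ≤ ((σ : ℂ) + ((τ + u * κ : ℝ) : ℂ) * I).re := by simpa using hσ
  have h := abs_eulerLogRe_coeff_le hε p hs
  simpa using h

/-- `log|L(·, ψ)|` is continuous along a vertical line `Re s = σ > 1`. [folklore] -/
theorem continuous_log_norm_LFunction_line [NeZero q] (ψ : DirichletCharacter ℂ q) {σ : ℝ} (hσ : 1 < σ)
    (τ κ : ℝ) :
    Continuous fun u : ℝ ↦ Real.log ‖ψ.LFunction ((σ : ℂ) + ((τ + u * κ : ℝ) : ℂ) * I)‖ := by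
  have hline : Continuous fun u : ℝ ↦ (σ : ℂ) + ((τ + u * κ : ℝ) : ℂ) * I := by fun_prop
  have hre : ∀ u : ℝ, ((σ : ℂ) + ((τ + u * κ : ℝ) : ℂ) * I).re = σ := by intro u; simp
  have hL : Continuous fun u : ℝ ↦ ψ.LFunction ((σ : ℂ) + ((τ + u * κ : ℝ) : ℂ) * I) := by
    refine continuous_iff_continuousAt.2 fun u ↦ ?_
    have hne : (σ : ℂ) + ((τ + u * κ : ℝ) : ℂ) * I ≠ 1 := by
      intro h
      have := congrArg Complex.re h
      rw [hre] at this
      simp only [Complex.one_re] at this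
      linarith
    exact ContinuousAt.comp (f := fun u : ℝ ↦ (σ : ℂ) + ((τ + u * κ : ℝ) : ℂ) * I)
      (DirichletCharacter.differentiableAt_LFunction ψ _ (Or.inl hne)).continuousAt hline.continuousAt
  refine hL.norm.log fun u ↦ ?_
  exact (norm_pos_iff.mpr (DirichletCharacter.LFunction_ne_zero_of_one_le_re ψ
    (Or.inr (by intro h; have := congrArg Complex.re h; rw [hre] at this; simp at this; linarith))
    (by rw [hre]; exact hσ.le))).ne'

/-- `log|L(s(u), ψ)|/cosh²u` is integrable along a vertical line `Re s = σ > 1`. [folklore] -/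
theorem integrable_log_norm_LFunction_line [NeZero q] (ψ : DirichletCharacter ℂ q) {σ : ℝ} (hσ : 1 < σ)
    (τ κ : ℝ) :
    Integrable fun u : ℝ ↦
      Real.log ‖ψ.LFunction ((σ : ℂ) + ((τ + u * κ : ℝ) : ℂ) * I)‖ / Real.cosh u ^ 2 := by
  refine integrable_div_cosh_sq_of_bound (continuous_log_norm_LFunction_line ψ hσ τ κ)
    (M := 3 / 2 * ∑' p : Nat.Primes, (p : ℝ) ^ (-σ)) fun u ↦ ?_
  have hs : 1 < ((σ : ℂ) + ((τ + u * κ : ℝ) : ℂ) * I).re := by simpa using hσ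
  have h := abs_log_norm_LFunction_le ψ hs
  simpa using h

/-! ## The inner interchange: one Euler factor with a phase along one line -/

/-- **One Euler factor with a phase, one line, summed over prime powers**: for `σ > 1`,
`∫ Re(−log(1 − e^{iφ}p^{−σ−i(τ+κu)}))/cosh²u du = Σ_{m ≥ 1} m⁻¹e^{−mσ log p} U(mκ log p) cos(m(τ log p − φ))`
with `U(y) = 2|Γ(1 + iy/2)|² = ∫ cos(yu)/cosh²u du` (dominated convergence, Ford's (5.3)).
[cite: Khale2024, Lemma 7.1 (proof)] -/
theorem hasSum_integral_euler_line_phase (p : Nat.Primes) {σ : ℝ} (hσ : 1 < σ) (φ τ κ : ℝ) :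
    HasSum (fun n : ℕ ↦ Real.exp (-(n * (σ * Real.log p))) / n *
        (2 * ‖Complex.Gamma (1 + ((n * (Real.log p * κ) / 2 : ℝ) : ℂ) * I)‖ ^ 2
          * Real.cos (n * (Real.log p * τ - φ))))
      (∫ u : ℝ, (-Complex.log (1 - Complex.exp ((φ : ℂ) * I) *
          (p : ℂ) ^ (-((σ : ℂ) + ((τ + u * κ : ℝ) : ℂ) * I)))).re / Real.cosh u ^ 2) := by
  set L : ℝ := Real.log p with hL
  set c : ℕ → ℝ := fun n ↦ Real.exp (-(n * (σ * L))) / n with hc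
  have hc0 : ∀ n, 0 ≤ c n := fun n ↦ div_nonneg (Real.exp_pos _).le n.cast_nonneg
  have hcsum : Summable c := (hasSum_eulerLogRe_real p (by linarith : 0 < σ)).summable
  have hε : ‖Complex.exp ((φ : ℂ) * I)‖ ≤ 1 := by rw [Complex.norm_exp_ofReal_mul_I]
  have hF := hasSum_integral_of_dominated_convergence (μ := volume)
    (F := fun (n : ℕ) (u : ℝ) ↦ c n * (Real.cos (n * (L * τ - φ) + (n * (L * κ)) * u) / Real.cosh u ^ 2))
    (f := fun u : ℝ ↦ (-Complex.log (1 - Complex.exp ((φ : ℂ) * I) *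
        (p : ℂ) ^ (-((σ : ℂ) + ((τ + u * κ : ℝ) : ℂ) * I)))).re / Real.cosh u ^ 2)
    (fun n u ↦ c n * (1 / Real.cosh u ^ 2)) ?_ ?_ ?_ ?_ ?_
  · refine hF.congr_fun fun n ↦ ?_
    rw [integral_const_mul, integral_cos_add_mul_div_cosh_sq]
  · intro n
    refine (continuous_const.mul ?_).aestronglyMeasurable
    exact (Continuous.div (by fun_prop) (by fun_prop) fun u ↦ by positivity)
  · intro n
    refine ae_of_all _ fun u ↦ ?_
    have hch : 0 < Real.cosh u ^ 2 := by positivity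
    rw [Real.norm_eq_abs, abs_mul, abs_of_nonneg (hc0 n), abs_div, abs_of_pos hch]
    exact mul_le_mul_of_nonneg_left
      (div_le_div_of_nonneg_right (Real.abs_cos_le_one _) hch.le) (hc0 n)
  · exact ae_of_all _ fun u ↦ hcsum.mul_right _
  · have e : (fun u : ℝ ↦ ∑' n : ℕ, c n * (1 / Real.cosh u ^ 2)) =
        fun u ↦ (∑' n : ℕ, c n) * (1 / Real.cosh u ^ 2) := by
      funext u; exact tsum_mul_right
    rw [e]
    exact integrable_inv_cosh_sq.const_mul _
  · refine ae_of_all _ fun u ↦ ?_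
    have h := (hasSum_eulerLogRe_line_phase p (by linarith : 0 < σ) φ (τ + u * κ)).div_const
      (Real.cosh u ^ 2)
    refine h.congr_fun fun n ↦ ?_
    simp only [hc, hL]
    rw [mul_div_assoc]
    congr 2
    ring

/-! ## The per-prime lower bound -/

/-- **The per-prime inequality** for `L(s, χ^j)`: for `σ > 1` and a prime `p`,
`Σ_{j=1}^{K} b_j ∫ Re(−log(1 − χ^j(p) p^{−σ−i(jt₁+κu)}))/cosh²u du ≥ −2b₀ Re(−log(1 − p^{−σ}))`
(for `p ∤ q`: Ford's argument with the phase `arg χ(p)`; for `p ∣ q` the left side vanishes).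
[cite: Khale2024, Lemma 7.1 (proof)] -/
theorem sum_integral_euler_char_ge (χ : DirichletCharacter ℂ q) (p : Nat.Primes) {σ : ℝ}
    (hσ : 1 < σ) {K : ℕ} {b : ℕ → ℝ} (hb : IsNonnegTrigPoly K b) (t₁ κ : ℝ) :
    -2 * b 0 * (-Complex.log (1 - (p : ℂ) ^ (-(σ : ℂ)))).re ≤
      ∑ j ∈ Finset.range K, b (j + 1) *
        ∫ u : ℝ, (-Complex.log (1 - (χ ^ (j + 1)) ((p : ℕ) : ZMod q) * (p : ℂ) ^
            (-((σ : ℂ) + ((((j : ℝ) + 1) * t₁ + u * κ : ℝ) : ℂ) * I)))).re / Real.cosh u ^ 2 := by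
  set L : ℝ := Real.log p with hL
  have hb0 : 0 ≤ b 0 := hb.1 0
  have hLft := (hasSum_eulerLogRe_real p (by linarith : 0 < σ)).mul_left (-2 * b 0)
  by_cases hpq : (p : ℕ) ∣ q
  · -- `p ∣ q`: every `χ^{j+1}(p) = 0`, the integrals vanish, and the left side is `≤ 0`
    have h0 : ∀ j : ℕ, (χ ^ (j + 1)) ((p : ℕ) : ZMod q) = 0 :=
      fun j ↦ pow_apply_prime_of_dvd χ p.prop hpq (j + 1)
    simp only [h0, zero_mul, sub_zero, Complex.log_one, neg_zero, Complex.zero_re, zero_div,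
      integral_zero, mul_zero, Finset.sum_const_zero]
    have hpos : 0 ≤ (-Complex.log (1 - (p : ℂ) ^ (-(σ : ℂ)))).re :=
      (hasSum_eulerLogRe_real p (by linarith : 0 < σ)).nonneg fun n ↦
        div_nonneg (Real.exp_pos _).le n.cast_nonneg
    nlinarith
  · -- `p ∤ q`: `χ^{j+1}(p) = e^{i(j+1)θ}`, `θ = arg χ(p)`
    set θ : ℝ := Complex.arg (χ ((p : ℕ) : ZMod q)) with hθ
    have hχj : ∀ j : ℕ, (χ ^ (j + 1)) ((p : ℕ) : ZMod q) =
        Complex.exp (((((j : ℝ) + 1) * θ : ℝ) : ℂ) * I) := by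
      intro j
      rw [pow_apply_prime_of_not_dvd χ p.prop hpq (j + 1), ← hθ]
      push_cast
      ring_nf
    simp_rw [hχj]
    have hR := hasSum_sum (s := Finset.range K) fun j _ ↦
      (hasSum_integral_euler_line_phase p hσ (((j : ℝ) + 1) * θ) (((j : ℝ) + 1) * t₁) κ).mul_left
        (b (j + 1))
    refine hasSum_le (fun n ↦ ?_) hLft hR
    -- termwise: `-2 b₀ c ≤ Σ_j b_{j+1} c U cos((j+1) x)` with `x = n (t₁ log p − θ)`
    set c : ℝ := Real.exp (-(n * (σ * L))) / n
    set U : ℝ := 2 * ‖Complex.Gamma (1 + ((n * (L * κ) / 2 : ℝ) : ℂ) * I)‖ ^ 2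
    have hc0 : 0 ≤ c := div_nonneg (Real.exp_pos _).le n.cast_nonneg
    have hU0 : 0 ≤ U := by positivity
    have hU2 : U ≤ 2 := two_mul_norm_Gamma_sq_le_two _
    have htrig := sum_mul_cos_ge hb (n * (L * t₁ - θ))
    have e : ∑ j ∈ Finset.range K, b (j + 1) *
        (c * (U * Real.cos (n * (L * (((j : ℝ) + 1) * t₁) - ((j : ℝ) + 1) * θ))))
        = c * U * ∑ j ∈ Finset.range K, b (j + 1) * Real.cos (((j : ℝ) + 1) * (n * (L * t₁ - θ))) := by
      rw [Finset.mul_sum]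
      refine Finset.sum_congr rfl fun j _ ↦ ?_
      rw [show (n : ℝ) * (L * (((j : ℝ) + 1) * t₁) - ((j : ℝ) + 1) * θ)
          = ((j : ℝ) + 1) * (n * (L * t₁ - θ)) by ring]
      ring
    rw [e]
    have h1 : c * U * (-b 0) ≤ c * U * ∑ j ∈ Finset.range K, b (j + 1) *
        Real.cos (((j : ℝ) + 1) * (n * (L * t₁ - θ))) :=
      mul_le_mul_of_nonneg_left htrig (mul_nonneg hc0 hU0)
    have h2 : -2 * b 0 * c ≤ c * U * (-b 0) := by nlinarith [mul_nonneg hc0 hb0]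
    exact h2.trans h1

/-! ## The outer interchange and Lemma 7.1 -/

/-- **Khale's Lemma 7.1, core form, every degree and every real part `σ > 1`**: for a Dirichlet
character `χ` mod `q`, a non-negative cosine polynomial `b` of degree `K` and real `t₁, κ`,
`−2b₀ log|ζ(σ)| ≤ ∫ Σ_{j=1}^{K} b_j log|L(σ + i(jt₁ + κu), χ^j)|/cosh²u du`.
[cite: Khale2024, Lemma 7.1] -/
theorem lemma71_core [NeZero q] (χ : DirichletCharacter ℂ q) {σ : ℝ} (hσ : 1 < σ) {K : ℕ} {b : ℕ → ℝ}
    (hb : IsNonnegTrigPoly K b) (t₁ κ : ℝ) :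
    -2 * b 0 * Real.log ‖riemannZeta σ‖ ≤
      ∫ u : ℝ, ∑ j ∈ Finset.range K, b (j + 1) *
        (Real.log ‖(χ ^ (j + 1)).LFunction ((σ : ℂ) + ((((j : ℝ) + 1) * t₁ + u * κ : ℝ) : ℂ) * I)‖
          / Real.cosh u ^ 2) := by
  set B₁ : ℝ := ∑ j ∈ Finset.range K, b (j + 1) with hB₁
  have hB₁0 : 0 ≤ B₁ := Finset.sum_nonneg fun j _ ↦ hb.1 (j + 1)
  have hS := summable_prime_rpow_neg hσ
  have hre : ∀ (j : ℕ) (u : ℝ),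
      ((σ : ℂ) + ((((j : ℝ) + 1) * t₁ + u * κ : ℝ) : ℂ) * I).re = σ := by intro j u; simp
  have hεj : ∀ (j : ℕ) (p : Nat.Primes), ‖(χ ^ (j + 1)) ((p : ℕ) : ZMod q)‖ ≤ 1 :=
    fun j p ↦ (χ ^ (j + 1)).norm_le_one _
  -- dominated convergence over the primes
  have hF := hasSum_integral_of_dominated_convergence (μ := volume) (ι := Nat.Primes)
    (F := fun (p : Nat.Primes) (u : ℝ) ↦ ∑ j ∈ Finset.range K, b (j + 1) *
      ((-Complex.log (1 - (χ ^ (j + 1)) ((p : ℕ) : ZMod q) * (p : ℂ) ^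
          (-((σ : ℂ) + ((((j : ℝ) + 1) * t₁ + u * κ : ℝ) : ℂ) * I)))).re / Real.cosh u ^ 2))
    (f := fun u : ℝ ↦ ∑ j ∈ Finset.range K, b (j + 1) *
        (Real.log ‖(χ ^ (j + 1)).LFunction ((σ : ℂ) + ((((j : ℝ) + 1) * t₁ + u * κ : ℝ) : ℂ) * I)‖
          / Real.cosh u ^ 2))
    (fun p u ↦ B₁ * (3 / 2 * (p : ℝ) ^ (-σ)) * (1 / Real.cosh u ^ 2)) ?_ ?_ ?_ ?_ ?_
  · -- compare the two `HasSum`s over the primes termwise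
    have hσ' : 1 < ((σ : ℝ) : ℂ).re := by simpa using hσ
    have hLft := (hasSum_eulerLogRe hσ').mul_left (-2 * b 0)
    refine hasSum_le (fun p ↦ ?_) hLft hF
    rw [integral_finsetSum _ fun j _ ↦
      (integrable_eulerLogRe_coeff_line (hεj j p) p hσ.le _ κ).const_mul _]
    simp_rw [integral_const_mul]
    exact sum_integral_euler_char_ge χ p hσ hb t₁ κ
  · -- measurability
    intro p
    refine (continuous_finsetSum _ fun j _ ↦ continuous_const.mul ?_).aestronglyMeasurable
    exact (continuous_eulerLogRe_coeff_line (hεj j p) p (by linarith) _ κ).div (by fun_prop)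
      fun u ↦ by positivity
  · -- domination
    intro p
    refine ae_of_all _ fun u ↦ ?_
    have hch : 0 < Real.cosh u ^ 2 := by positivity
    calc ‖∑ j ∈ Finset.range K, b (j + 1) * ((-Complex.log (1 - (χ ^ (j + 1)) ((p : ℕ) : ZMod q) *
            (p : ℂ) ^ (-((σ : ℂ) + ((((j : ℝ) + 1) * t₁ + u * κ : ℝ) : ℂ) * I)))).re / Real.cosh u ^ 2)‖
        ≤ ∑ j ∈ Finset.range K, ‖b (j + 1) * ((-Complex.log (1 - (χ ^ (j + 1)) ((p : ℕ) : ZMod q) *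
            (p : ℂ) ^ (-((σ : ℂ) + ((((j : ℝ) + 1) * t₁ + u * κ : ℝ) : ℂ) * I)))).re / Real.cosh u ^ 2)‖ :=
          norm_sum_le _ _
      _ ≤ ∑ j ∈ Finset.range K, b (j + 1) * ((3 / 2 * (p : ℝ) ^ (-σ)) * (1 / Real.cosh u ^ 2)) := by
          refine Finset.sum_le_sum fun j _ ↦ ?_
          have hg := abs_eulerLogRe_coeff_le (hεj j p) p
            (s := (σ : ℂ) + ((((j : ℝ) + 1) * t₁ + u * κ : ℝ) : ℂ) * I) (by rw [hre]; exact hσ.le)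
          rw [hre] at hg
          rw [norm_mul, Real.norm_of_nonneg (hb.1 _), Real.norm_eq_abs, abs_div, abs_of_pos hch,
            ← mul_one_div _ (Real.cosh u ^ 2)]
          exact mul_le_mul_of_nonneg_left (mul_le_mul_of_nonneg_right hg (by positivity)) (hb.1 _)
      _ = B₁ * (3 / 2 * (p : ℝ) ^ (-σ)) * (1 / Real.cosh u ^ 2) := by
          rw [← Finset.sum_mul, hB₁]; ring
  · -- summability of the dominating sequence
    exact ae_of_all _ fun u ↦ ((hS.mul_left (3 / 2)).mul_left B₁).mul_right _
  · -- integrability of its sum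
    have e : (fun u : ℝ ↦ ∑' p : Nat.Primes, B₁ * (3 / 2 * (p : ℝ) ^ (-σ)) * (1 / Real.cosh u ^ 2))
        = fun u ↦ (∑' p : Nat.Primes, B₁ * (3 / 2 * (p : ℝ) ^ (-σ))) * (1 / Real.cosh u ^ 2) := by
      funext u; exact tsum_mul_right
    rw [e]
    exact integrable_inv_cosh_sq.const_mul _
  · -- pointwise Euler product on each of the `K` lines
    refine ae_of_all _ fun u ↦ hasSum_sum fun j _ ↦ ?_
    have h := hasSum_eulerLogRe_char (χ ^ (j + 1))
      (s := (σ : ℂ) + ((((j : ℝ) + 1) * t₁ + u * κ : ℝ) : ℂ) * I) (by rw [hre]; exact hσ)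
    exact (h.div_const (Real.cosh u ^ 2)).mul_left (b (j + 1))

/-- **Khale 2024, Lemma 7.1** (sum-of-integrals form, every degree, every real part `σ > 1`):
`Σ_{j=1}^{K} b_j ∫_{-∞}^{∞} log|L(σ + ijt₁ + iut₂, χ^j)|/cosh²u du ≥ −2b₀ log ζ(σ)`.
[cite: Khale2024, Lemma 7.1] -/
theorem lemma71 [NeZero q] (χ : DirichletCharacter ℂ q) {σ : ℝ} (hσ : 1 < σ) {K : ℕ} {b : ℕ → ℝ}
    (hb : IsNonnegTrigPoly K b) (t₁ t₂ : ℝ) :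
    -2 * b 0 * Real.log (riemannZeta σ).re ≤
      ∑ j ∈ Finset.range K, b (j + 1) *
        ∫ u : ℝ, Real.log ‖(χ ^ (j + 1)).LFunction
            ((σ : ℂ) + ((((j : ℝ) + 1) * t₁ + u * t₂ : ℝ) : ℂ) * I)‖ / Real.cosh u ^ 2 := by
  have h := lemma71_core χ hσ hb t₁ t₂
  rw [integral_finsetSum _ fun j _ ↦ (integrable_log_norm_LFunction_line (χ ^ (j + 1)) hσ _ t₂).const_mul _]
    at h
  simp_rw [integral_const_mul] at h
  rwa [re_zeta_eq_norm hσ]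

/-! ### `ζ` decreases on `(1, ∞)` and the printed form -/

/-- `ζ(y) ≤ ζ(x)` for real `1 < x ≤ y` (termwise `n^{−y} ≤ n^{−x}`). [folklore] -/
theorem re_riemannZeta_antitone {x y : ℝ} (hx : 1 < x) (hxy : x ≤ y) :
    (riemannZeta y).re ≤ (riemannZeta x).re := by
  have hy : 1 < y := lt_of_lt_of_le hx hxy
  have hser : ∀ {z : ℝ}, 1 < z →
      HasSum (fun n : ℕ ↦ 1 / (n : ℝ) ^ z) (riemannZeta z).re := by
    intro z hz
    have hz' : 1 < ((z : ℂ)).re := by simpa using hz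
    have hsum : Summable fun n : ℕ ↦ 1 / (n : ℂ) ^ (z : ℂ) := Complex.summable_one_div_nat_cpow.mpr hz'
    have h := Complex.hasSum_re hsum.hasSum
    rw [← zeta_eq_tsum_one_div_nat_cpow hz'] at h
    refine h.congr_fun fun n ↦ ?_
    rw [eq_comm]
    rw [show (n : ℂ) = ((n : ℝ) : ℂ) by simp, ← Complex.ofReal_cpow n.cast_nonneg, ← Complex.ofReal_one,
      ← Complex.ofReal_div, Complex.ofReal_re]
  refine hasSum_le (fun n ↦ ?_) (hser hy) (hser hx)
  rcases Nat.eq_zero_or_pos n with rfl | hn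
  · simp [Real.zero_rpow (by linarith : y ≠ 0), Real.zero_rpow (by linarith : x ≠ 0)]
  · have hn' : (1 : ℝ) ≤ n := by exact_mod_cast hn
    exact one_div_le_one_div_of_le (by positivity) (Real.rpow_le_rpow_of_exponent_le hn' hxy)

/-- **Khale 2024, Lemma 7.1 as printed** (`L`-functions on the line `Re s = σ + η`, `σ ≥ 1`, `η > 0`,
against `ζ(1 + η)`): `Σ_{j=1}^{K} b_j ∫ log|L(σ + η + ijt₁ + iut₂, χ^j)|/cosh²u du ≥ −2b₀ log ζ(1 + η)`.
[cite: Khale2024, Lemma 7.1] -/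
theorem lemma71_printed [NeZero q] (χ : DirichletCharacter ℂ q) {σ η : ℝ} (hσ : 1 ≤ σ) (hη : 0 < η) {K : ℕ}
    {b : ℕ → ℝ} (hb : IsNonnegTrigPoly K b) (t₁ t₂ : ℝ) :
    -2 * b 0 * Real.log (riemannZeta (1 + η)).re ≤
      ∑ j ∈ Finset.range K, b (j + 1) *
        ∫ u : ℝ, Real.log ‖(χ ^ (j + 1)).LFunction
            (((σ + η : ℝ) : ℂ) + ((((j : ℝ) + 1) * t₁ + u * t₂ : ℝ) : ℂ) * I)‖ / Real.cosh u ^ 2 := by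
  have h1 : 1 < σ + η := by linarith
  refine le_trans ?_ (lemma71 χ h1 hb t₁ t₂)
  have hb0 : 0 ≤ b 0 := hb.1 0
  have hmono : (riemannZeta ((σ + η : ℝ) : ℂ)).re ≤ (riemannZeta ((1 + η : ℝ) : ℂ)).re :=
    re_riemannZeta_antitone (by linarith) (by linarith)
  have hpos : 0 < (riemannZeta ((σ + η : ℝ) : ℂ)).re := by
    rw [re_zeta_eq_norm h1]
    exact norm_pos_iff.mpr (riemannZeta_ne_zero_of_one_lt_re (by simp; linarith))
  have hlog : Real.log (riemannZeta ((σ + η : ℝ) : ℂ)).re ≤ Real.log (riemannZeta (1 + η)).re := by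
    rw [show (1 : ℂ) + η = ((1 + η : ℝ) : ℂ) by push_cast; ring]
    exact Real.log_le_log hpos hmono
  nlinarith

end KhaleL71

end Literature.NumberTheory.LFunctions
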